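import Literature.Geometry.GeometricMeasureTheory.CurrentsNullSupport
import Literature.Geometry.GeometricMeasureTheory.RectifiableAdd

/-!
# A locally rectifiable current supported in an `𝓗^m`-null set vanishes

If `T = [W, θ, ξ] ∈ 𝓡_m^{loc}(Ω)` and `spt T ⊆ Z` with `𝓗^m(Z) = 0`, then `T = 0`: the density
`θ • ξ` vanishes a.e. off the support ([Federer1969, 4.1.5, 4.1.7], `CurrentsNullSupport.lean`),
and `𝓗^m ⌞ W` does not charge the support. In particular an `(m+1)`-dimensional rectifiable
current carried by a set of locally finite `𝓗^m`-measure is zero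
(`Current.IsLocallyRectifiable.eq_zero_of_support_subset_of_hausdorffMeasure_lt_top`,
[Federer1969, 2.10.19 / `hausdorffMeasure_zero_or_top`]) — used for homotopies running inside a
`p`-dimensional analytic set (King's tangent cone theorem).

Theorems only; no named facts.

## References

* H. Federer, *Geometric Measure Theory*, Springer 1969, 4.1.5, 4.1.7, 4.1.28 [Federer1969].
-/

noncomputable section

open scoped ENNReal Topology
open MeasureTheory Set Filter TopologicalSpace

namespace Literature.Geometry.GeometricMeasureTheory

-- Nested operator-norm instances on (duals of) `V [⋀^Fin m]→L[ℝ] ℝ`.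
set_option maxSynthPendingDepth 2

variable {V : Type*} [NormedAddCommGroup V] [InnerProductSpace ℝ V] [FiniteDimensional ℝ V]
  [MeasurableSpace V] [BorelSpace V] {Ω : Opens V} {m : ℕ}

/-- **A locally rectifiable current supported in an `𝓗^m`-null set is zero.**
[cite: Federer1969, 4.1.5, 4.1.7, 4.1.28] -/
theorem Current.IsLocallyRectifiable.eq_zero_of_support_subset_null {T : Current Ω m}
    (hT : T.IsLocallyRectifiable) {Z : Set V} (hZ : T.support ⊆ Z)
    (hμ : (μHE[m] : Measure V) Z = 0) : T = 0 := by
  obtain ⟨W, θ, ξ, hd, rfl⟩ := hT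
  have hWm : MeasurableSet W := hd.1
  have hWΩ : W ⊆ (Ω : Set V) := hd.2.1
  set μ : Measure V := (μHE[m] : Measure V).restrict W with hμdef
  set η : V → Multivector V m := fun x => (θ x : ℝ) • frameVector (ξ x) with hη
  have hloc : LocallyIntegrableOn η (Ω : Set V) μ := hd.2.2.2.1
  -- the density vanishes a.e. off the support, and the support is `μ`-null
  have h1 := ae_eq_zero_of_mem_sdiff_support_vectorCurrent (m := m) (Ω := Ω) hloc
  have h2 : ∀ᵐ y ∂μ, y ∉ (vectorCurrent μ η : Current Ω m).support := by
    refine measure_eq_zero_iff_ae_notMem.1 (measure_mono_null hZ ?_)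
    exact le_antisymm ((Measure.restrict_le_self _).trans hμ.le) bot_le
  have h3 : ∀ᵐ y ∂μ, y ∈ (Ω : Set V) := by
    rw [hμdef]
    filter_upwards [ae_restrict_mem hWm] with y hy using hWΩ hy
  have hae : η =ᵐ[μ] (fun _ => 0) := by
    filter_upwards [h1, h2, h3] with y h1 h2 h3
    exact h1 ⟨h3, h2⟩
  change (vectorCurrent μ η : Current Ω m) = 0
  rw [vectorCurrent_congr_ae hae]
  ext φ
  rw [vectorCurrent_apply (locallyIntegrableOn_zero (ε'' := Multivector V m))]
  simp

/-- **An `(m+1)`-dimensional locally rectifiable current carried by a set of locally finite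
`𝓗^m`-measure is zero** (then `𝓗^{m+1}` of the set vanishes on compacts; supports are tested on
an exhaustion by compacts). [cite: Federer1969, 2.10.19, 4.1.28] -/
theorem Current.IsRectifiable.eq_zero_of_support_subset_of_hausdorffMeasure_ne_top
    {T : Current Ω (m + 1)} (hT : T.IsRectifiable) {Z : Set V} (hZ : T.support ⊆ Z)
    (hμ : (μH[m] : Measure V) (Z ∩ T.support) ≠ ⊤) : T = 0 := by
  refine hT.1.eq_zero_of_support_subset_null (Z := Z ∩ T.support) (fun x hx => ⟨hZ hx, hx⟩) ?_
  have h := (Measure.hausdorffMeasure_zero_or_top (by exact_mod_cast Nat.lt_succ_self m :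
    ((m : ℝ)) < ((m + 1 : ℕ) : ℝ)) (Z ∩ T.support)).resolve_right hμ
  rw [Measure.euclideanHausdorffMeasure_def, Measure.smul_apply, smul_eq_zero]
  exact Or.inr (by exact_mod_cast h)

end Literature.Geometry.GeometricMeasureTheory
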